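import Summits.BirchSwinnertonDyer.BirchSwinnertonDyer.Theorems.ErratumRoadFiveSigmaLocalTotallySplit
import HarnessLib

/-!
# The local `Σ`-atom 20495 `JSWSigmaLocalCharIdeal` REDUCED TO ITS FINITELY DECOMPOSED HALF (`c ≠ 0`)

Cell `bsd-stepL`, K2 route `ErratumRoadFive`, support item 20495 `JSWSigmaLocalCharIdeal`
(= `JetchevSkinnerWan2017.sigmaLocal_charIdeal_eulerFactor_mem_of_noTamagawaDefect`), seat
`bsd-stepL-imc-p1` (g13). THEOREMS ONLY (no definition, no named fact, no `sorry`).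

`sigmaLocal_of_finitelyDecomposed`: the atom FOLLOWS from its restriction to the places with Frobenius
exponent `c ≠ 0` (the FINITELY DECOMPOSED places — every `w ∤ p` over a prime split in `K`, Brink 2007;
there `NoTamagawaDefect` is vacuous), because its restriction to the TOTALLY SPLIT places (`c = 0`) is the
tree theorem `SigmaLocal.sigmaLocal_of_isEulerDataAt_zero` (file `ErratumRoadFiveSigmaLocalTotallySplit`,
modules L3 + L4a + L4b). The hypothesis is spelled INLINE as a `∀`-statement with exactly the atom's
binders plus `c ≠ 0` (no new named fact): it is the Greenberg–Vatsal 2000 Prop. 2.4 ∕ Skinner 2016 §2.3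
local computation `Ch_Λ(H¹(K_w, T⊗Λ^*(Ψ⁻¹))^∨) ∋ P_w(Nw⁻¹γ_w)` (module L5 of the discharge plan, OPEN).

HONEST FRAMING: a conditional reduction; the atom is NOT discharged; nothing about BSD is claimed;
closes: none (T7).

References: [GreenbergVatsal2000] Prop. 2.4; [Skinner2016PacificMC] §2.3 (p. 180); [JetchevSkinnerWan2017]
proof of Thm. 6.1.6 (local display); [Brink2007] Thm. 2; [PollackWeston2011] Lemma 3.2; [Castella2018] (2.7), Prop. 2.5.
-/

noncomputable section

open scoped Classical

open Field NumberField IsDedekindDomain WeierstrassCurve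
open Literature.NumberTheory.EllipticCurves Literature.NumberTheory.GaloisRepresentations
  Literature.NumberTheory.EllipticCurves.BigGaloisRep Literature.NumberTheory.EllipticCurves.IwasawaCharacter
  Literature.NumberTheory.EllipticCurves.JetchevSkinnerWan2017

set_option autoImplicit false
-- the Theorems namespace of this sub repeats the summit name by design (D-0017 nested layout)
set_option linter.dupNamespace false

namespace Summit.BirchSwinnertonDyer.BirchSwinnertonDyer.Theorems.SigmaLocal

/-- **K2 support 20495 `JSWSigmaLocalCharIdeal` reduced to the finitely decomposed places.** If the
local statement holds at every place `w ∤ p` with Euler datum `(Nw, t, c)`, `c ≠ 0` (Greenberg–Vatsal 2000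
Prop. 2.4 ∕ Skinner 2016 §2.3: "the `Λ_𝒪`-characteristic ideal of its Pontryagin dual is generated by
`P_ℓ(Ψ⁻¹ε⁻¹(frob_ℓ))`" — module L5, stated inline with the atom's binders), then
`sigmaLocal_charIdeal_eulerFactor_mem_of_noTamagawaDefect` holds: the places with `c = 0` are the theorem
`sigmaLocal_of_isEulerDataAt_zero`. [cite: GreenbergVatsal2000, Prop. 2.4]
[cite: Skinner2016PacificMC, §2.3 (p. 180)] [cite: JetchevSkinnerWan2017, proof of Thm. 6.1.6 (local display) and §5.1 Remark]
[cite: PollackWeston2011, Lemma 3.2] -/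
theorem sigmaLocal_of_finitelyDecomposed
    (hL5 : ∀ (W : WeierstrassCurve ℚ) [W.IsElliptic] (p : ℕ) [Fact p.Prime], 3 ≤ p →
      ∀ (K : Type) [Field K] [NumberField K], IsImaginaryQuadratic K →
      ∀ (κ : ZpExtension K p), κ.IsAnticyclotomic →
      ∀ (w : HeightOneSpectrum (𝓞 K)), ((p : ℕ) : 𝓞 K) ∉ w.asIdeal →
      ∀ (Nw : ℕ) (t : LocalReductionData) (c : ℤ_[p]),
        IsEulerDataAt (W.baseChange K) κ w Nw t c → c ≠ 0 →
      ∀ [TopologicalSpace (IwasawaAlgebra p)]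
        [ContinuousSMul (IwasawaAlgebra p)
          (BigRepModule ℤ_[p] p (PrimaryTorsion (geomPoints (W.baseChange K)) p))],
        Module.Finite (IwasawaAlgebra p) (CharacterModule (continuousCohomology 1
          ((AnticyclotomicBigGaloisRep κ ((W.baseChange K).primaryTorsionGaloisRep p)).restrict
            (localMap K (Sum.inl w))).toTopRep)) ∧
        Module.IsTorsion (IwasawaAlgebra p) (CharacterModule (continuousCohomology 1
          ((AnticyclotomicBigGaloisRep κ ((W.baseChange K).primaryTorsionGaloisRep p)).restrict
            (localMap K (Sum.inl w))).toTopRep)) ∧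
        eulerFactor p ℤ_[p] Nw t c ∈ Module.charIdeal (IwasawaAlgebra p) (CharacterModule
          (continuousCohomology 1
            ((AnticyclotomicBigGaloisRep κ ((W.baseChange K).primaryTorsionGaloisRep p)).restrict
              (localMap K (Sum.inl w))).toTopRep))) :
    sigmaLocal_charIdeal_eulerFactor_mem_of_noTamagawaDefect := by
  intro W _ p _ hp K _ _ hK κ hκ w hw Nw t c hdata hB _ _
  by_cases hc : c = 0
  · subst hc
    haveI : (W.baseChange K).IsElliptic := by
      rw [WeierstrassCurve.baseChange]; infer_instance
    exact sigmaLocal_of_isEulerDataAt_zero (W.baseChange K) p hp κ w hw Nw t hdata hB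
  · exact hL5 W p hp K hK κ hκ w hw Nw t c hdata hc

end Summit.BirchSwinnertonDyer.BirchSwinnertonDyer.Theorems.SigmaLocal

end
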